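import Literature.Uncategorized.Crux
import Literature.Topology.FourManifolds.Rasmussen
import Literature.Topology.FourManifolds.RasmussenConcordanceProofs
import HarnessLib

/-!
# `ZseCruxRasmussen` — negative knowledge IV: topological witnesses are dead; profile of a witness (mod Freedman)

Refuter support lemmas for crux `stmt-SmoothPoincare4-0366` (`Literature.Uncategorized.Crux`: knots `K, K'`
with a common `0`-surgery `Y`, `K` smoothly slice, `s(K') ≠ 0`), from the standing disprover's work file
`Summits/SmoothPoincare4/SmoothPoincare4/Cruxes/ZseCruxRasmussen/Disproof.lean` §8. Freedman's theorem enters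
as the spelled-out hypothesis `hF : ∀ K, K.IsHomotopyBallSlice → K.IsTopologicallySlice` (a homotopy 4-ball is
homeomorphic to `B⁴`, Freedman 1982, Thm. 1.6; a smooth disc is locally flat) — not a tree fact, no
definition here:

* `isTopologicallySlice_partner` — the partner `K'` of ANY `0`-surgery pair with `K` smoothly slice is
  topologically slice (Manolescu–Piccirillo Lemma 3.3, PROVED in the tree as
  `Literature.Uncategorized.isHomotopyBallSlice_of_zeroSurgeryPair`, then Freedman);
* `crux_topologicalWitness_false` — hence the variant of the crux whose witness clause is "`K'` is NOT
  topologically slice" is FALSE: no topological concordance obstruction (signatures, Levine–Tristram, Arf,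
  Fox–Milnor, Casson–Gordon, …) can ever certify the partner; the witness clause must be a smooth-only
  obstruction such as `s ≠ 0`;
* `crux_witness_profile` — collected profile of a witness (mod Rasmussen's Theorem 1 as well): `K'` is slice in
  a homotopy 4-ball, topologically slice, not smoothly slice, and not concordant to `K`.
No definitions; no route item is concluded positively.
References: Freedman 1982 Thm. 1.6 [Freedman1982]; Manolescu–Piccirillo 2023 Lemma 3.3 [ManolescuPiccirillo2023];
Rasmussen 2010 Thm. 1 [Rasmussen2010]; Fox–Milnor 1966 [FoxMilnor1966].
-/

noncomputable section

set_option linter.dupNamespace false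

namespace Summit.SmoothPoincare4.SmoothPoincare4.Theorems.ZseCruxRasmussen.Negative

open scoped Manifold ContDiff
open Literature.Topology.FourManifolds Literature.Uncategorized

/-- Mod Freedman (`hF`), the partner `K'` of a `0`-surgery pair with `K` smoothly slice is TOPOLOGICALLY
slice: it is slice in a homotopy 4-ball by Manolescu–Piccirillo's Lemma 3.3 (PROVED in the tree), and that
ball is homeomorphic to `B⁴`. [cite: ManolescuPiccirillo2023, Lemma 3.3] [cite: Freedman1982, Thm. 1.6] -/
theorem isTopologicallySlice_partner (hF : ∀ K : Knot, K.IsHomotopyBallSlice → K.IsTopologicallySlice)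
    {K K' : Knot} {Y : Type} [TopologicalSpace Y] [ChartedSpace (EuclideanSpace ℝ (Fin 3)) Y]
    (hK : IsIntegralSurgery (𝓡 3) Y K 0) (hK' : IsIntegralSurgery (𝓡 3) Y K' 0)
    (hsl : K.IsSmoothlySlice) : K'.IsTopologicallySlice :=
  hF K' (isHomotopyBallSlice_of_zeroSurgeryPair hK hK' hsl)

/-- **The topological-witness variant of the crux is FALSE** (mod Freedman): there is no `0`-surgery pair
with `K` smoothly slice and `K'` not topologically slice. [cite: ManolescuPiccirillo2023, Lemma 3.3]
[cite: Freedman1982, Thm. 1.6] -/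
theorem crux_topologicalWitness_false
    (hF : ∀ K : Knot, K.IsHomotopyBallSlice → K.IsTopologicallySlice) :
    ¬ ∃ (K K' : Knot) (Y : Type) (_ : TopologicalSpace Y) (_ : ChartedSpace (EuclideanSpace ℝ (Fin 3)) Y),
        IsIntegralSurgery (𝓡 3) Y K 0 ∧ IsIntegralSurgery (𝓡 3) Y K' 0 ∧ K.IsSmoothlySlice ∧
          ¬ K'.IsTopologicallySlice := by
  rintro ⟨K, K', Y, _, _, hK, hK', hsl, hnt⟩
  exact hnt (isTopologicallySlice_partner hF hK hK' hsl)

/-- **Profile of a witness** (mod Rasmussen's Theorem 1 `hR` and Freedman `hF`): in any witness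
`(K, K', Y, s)` of the crux the partner `K'` is slice in a homotopy 4-ball, topologically slice, NOT smoothly
slice, and NOT concordant to `K` (concordant to slice is slice — the tree's Fox–Milnor theorem
`Knot.IsConcordant.isSmoothlySlice`). [cite: ManolescuPiccirillo2023, Lemma 3.3] [cite: Rasmussen2010, Thm. 1]
[cite: FoxMilnor1966, §1] -/
theorem crux_witness_profile (hR : eq_zero_of_isSmoothlySlice)
    (hF : ∀ K : Knot, K.IsHomotopyBallSlice → K.IsTopologicallySlice)
    {K K' : Knot} {Y : Type} [TopologicalSpace Y] [ChartedSpace (EuclideanSpace ℝ (Fin 3)) Y] {s : ℤ}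
    (hK : IsIntegralSurgery (𝓡 3) Y K 0) (hK' : IsIntegralSurgery (𝓡 3) Y K' 0)
    (hsl : K.IsSmoothlySlice) (hs : K'.HasRasmussenInvariant s) (hs0 : s ≠ 0) :
    K'.IsHomotopyBallSlice ∧ K'.IsTopologicallySlice ∧ ¬ K'.IsSmoothlySlice ∧ ¬ K'.IsConcordant K :=
  ⟨isHomotopyBallSlice_of_zeroSurgeryPair hK hK' hsl, isTopologicallySlice_partner hF hK hK' hsl,
    fun hsl' ↦ hs0 (hR hs hsl'), fun hc ↦ hs0 (hR hs (hc.isSmoothlySlice hsl))⟩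

end Summit.SmoothPoincare4.SmoothPoincare4.Theorems.ZseCruxRasmussen.Negative

end
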